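import Mathlib.LinearAlgebra.CrossProduct
import Mathlib.Analysis.SpecialFunctions.Pow.Real
import HarnessLib

/-!
# K2R `RealisedQuasiStaticCellLaw`, line `floquet-bloch`: the unit normal of the plane of a principal coset
# (input `ζ` of the block decays; helper towards `stub_lowSectorDecay`; `--supports stmt-AnomalousDissipation-20446`)

Summits-side helper file (everything proved; no definitions, no named facts). For two real vectors `u, v : Fin 3 → ℝ` with
`u × v ≠ 0` (not parallel), `ζ = (√((u×v)·(u×v)))⁻¹ • (u × v)` is a unit vector normal to both (`exists_unit_normal`): the
frame vector `ζ` required by `outOfPlane_block_decay` / `inPlane_block_decay` / `sectorDecay_ae` for the principal coset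
`ℓ + ℤK_j` (`u = ℓ`, `v = K_j`; in a good slot `ê_j·ℓ ≠ 0` forces `ℓ ∦ m_j`).
-/

set_option linter.dupNamespace false

noncomputable section

namespace Summit.AnomalousDissipation.AnomalousDissipation.Theorems.SolenoidalFractalHomogenisation.RealisedQuasiStaticCellLaw

open Matrix
open scoped Matrix

/-- **Unit normal of a non-degenerate plane in `ℝ³`.** If `u × v ≠ 0` there is `ζ` with `ζ·ζ = 1`, `ζ·u = 0`, `ζ·v = 0`. -/
theorem exists_unit_normal (u v : Fin 3 → ℝ) (h : u ⨯₃ v ≠ 0) :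
    ∃ ζ : Fin 3 → ℝ, ζ ⬝ᵥ ζ = 1 ∧ ζ ⬝ᵥ u = 0 ∧ ζ ⬝ᵥ v = 0 := by
  set c := u ⨯₃ v with hc
  have hcc : 0 < c ⬝ᵥ c := by
    obtain ⟨i, hi⟩ : ∃ i, c i ≠ 0 := by
      by_contra h0
      push Not at h0
      exact h (funext h0)
    have e : c ⬝ᵥ c = ∑ l, c l ^ 2 := by simp [dotProduct, sq]
    rw [e]
    exact lt_of_lt_of_le (by positivity) (Finset.single_le_sum (fun l _ => sq_nonneg (c l)) (Finset.mem_univ i))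
  set ρ := Real.sqrt (c ⬝ᵥ c) with hρ
  have hρpos : 0 < ρ := Real.sqrt_pos.2 hcc
  have hρsq : ρ ^ 2 = c ⬝ᵥ c := Real.sq_sqrt hcc.le
  refine ⟨ρ⁻¹ • c, ?_, ?_, ?_⟩
  · rw [smul_dotProduct, dotProduct_smul, smul_eq_mul, smul_eq_mul, ← hρsq]
    field_simp
  · rw [smul_dotProduct, hc, dotProduct_comm, dot_self_cross, smul_zero]
  · rw [smul_dotProduct, hc, dotProduct_comm, dot_cross_self, smul_zero]

/-- Integer version: for lattice vectors `ℓ, K : Fin 3 → ℤ` whose real casts are not parallel, a real unit normal exists,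
in the form consumed by `sectorDecay_ae`. -/
theorem exists_unit_normal_int (ℓ K : Fin 3 → ℤ)
    (h : (fun i => ((ℓ i : ℤ) : ℝ)) ⨯₃ (fun i => ((K i : ℤ) : ℝ)) ≠ 0) :
    ∃ ζr : Fin 3 → ℝ, ζr ⬝ᵥ ζr = 1 ∧ ζr ⬝ᵥ (fun i => ((ℓ i : ℤ) : ℝ)) = 0 ∧ ζr ⬝ᵥ (fun i => ((K i : ℤ) : ℝ)) = 0 :=
  exists_unit_normal _ _ h

/-- Non-parallel test through a linear functional: if `e·u ≠ 0` while `e·v = 0` and `v ≠ 0`, then `u × v ≠ 0`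
(in a good slot, `ê_j·ℓ ≠ 0` and `ê_j ⊥ m_j` force `ℓ ∦ K_j`). -/
theorem cross_ne_zero_of_dot (u v e : Fin 3 → ℝ) (heu : e ⬝ᵥ u ≠ 0) (hev : e ⬝ᵥ v = 0) (hv : v ≠ 0) :
    u ⨯₃ v ≠ 0 := by
  intro h0
  -- `v × (u × v) = (v·v) u − (v·u) v = 0` would make `u` parallel to `v`, contradicting `e·u ≠ 0 = e·v`
  have h1 : v ⨯₃ (u ⨯₃ v) = (v ⬝ᵥ v) • u - (u ⬝ᵥ v) • v := cross_cross_eq_smul_sub_smul' v u v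
  rw [h0, map_zero, dotProduct_comm u v] at h1
  have hvv : 0 < v ⬝ᵥ v := by
    obtain ⟨i, hi⟩ : ∃ i, v i ≠ 0 := by
      by_contra h2
      push Not at h2
      exact hv (funext h2)
    have e' : v ⬝ᵥ v = ∑ l, v l ^ 2 := by simp [dotProduct, sq]
    rw [e']
    exact lt_of_lt_of_le (by positivity) (Finset.single_le_sum (fun l _ => sq_nonneg (v l)) (Finset.mem_univ i))
  have h2 : (v ⬝ᵥ v) • u = (v ⬝ᵥ u) • v := sub_eq_zero.1 h1.symm
  have h3 : (v ⬝ᵥ v) * (e ⬝ᵥ u) = (v ⬝ᵥ u) * (e ⬝ᵥ v) := by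
    have := congrArg (fun x => e ⬝ᵥ x) h2
    simpa [dotProduct_smul] using this
  rw [hev, mul_zero] at h3
  exact heu ((mul_eq_zero.1 h3).resolve_left hvv.ne')

end Summit.AnomalousDissipation.AnomalousDissipation.Theorems.SolenoidalFractalHomogenisation.RealisedQuasiStaticCellLaw

end
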